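import Summits.BirchSwinnertonDyer.Rank1Residual.ManinAdditive.KatoTwistManinBound
import Mathlib.RingTheory.IntegralClosure.IntegrallyClosed
import HarnessLib

/-!
# Proved glue for the Euler-system leaves of cell `bsd-f2-manin`: (♭) ⟹ (♯)

`unitTwistManinCriterion_of_katoTwistManinBound` : `KatoTwistManinBound → UnitTwistManinCriterion` — the
planner's `manin_glue_statement` (HOME/es/Sketch-es-g1.lean 03a85a17b998719d, audited REFUTER-ref1 §R6:
«10 lines of ord_p bookkeeping»): if `u · p · A⁺_f(χ) = c · y` with `y` an algebraic integer, `A⁺_f(χ) = r ∈ ℚ`,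
`p ∤ u` and `p ∤ num r`, then `y ∈ ℤ` (ℤ is integrally closed) and `p² ∣ c` would force `p ∣ u · num r`.
PROVED, no `sorry`, nothing new asserted.
-/

noncomputable section

open scoped BigOperators MatrixGroups ModularForm

open CongruenceSubgroup WeierstrassCurve
  Literature.NumberTheory.EllipticCurves Literature.NumberTheory.EllipticCurves.ModularForms

namespace Summit.BirchSwinnertonDyer.Rank1Residual.ManinAdditive

/-- An algebraic integer of `ℂ` which is (the image of) a rational number is an integer. -/
private theorem exists_int_cast_eq_of_isIntegral_ratCast {q : ℚ} (h : IsIntegral ℤ ((q : ℚ) : ℂ)) :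
    ∃ z : ℤ, (z : ℚ) = q := by
  have h' : IsIntegral ℤ (algebraMap ℚ ℂ q) := by rwa [eq_ratCast]
  rw [isIntegral_algebraMap_iff (algebraMap ℚ ℂ).injective] at h'
  obtain ⟨z, hz⟩ := IsIntegrallyClosed.isIntegral_iff.mp h'
  exact ⟨z, by simpa using hz⟩

/-- **(♭) ⟹ (♯)**: the Manin bound gives the unit-twist criterion (pure bookkeeping). -/
theorem unitTwistManinCriterion_of_katoTwistManinBound (h : KatoTwistManinBound) :
    UnitTwistManinCriterion := by
  intro W _ _ _ D p _ hp2 hΔ hc4 hirr hmin hχ hdvd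
  obtain ⟨m, hm, χ, r, hcop, hprim, hne, hquad, heven, hsum, hnum⟩ := hχ
  have hp : p.Prime := Fact.out
  obtain ⟨u, hu, y, hy, heq⟩ := h W D p hp2 hΔ hc4 hirr hmin m χ hcop hprim hne hquad heven
  rw [hsum] at heq
  -- `y` is rational: `y = u p r / c`
  have hc0 : (D.maninConstant : ℂ) ≠ 0 := by exact_mod_cast D.maninConstant_ne_zero_holds
  set q : ℚ := (u : ℚ) * p * r / D.maninConstant with hq
  have hyq : y = ((q : ℚ) : ℂ) := by
    rw [hq]
    push_cast
    field_simp
    rw [mul_comm]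
    exact heq.symm
  -- hence an integer
  obtain ⟨z, hz⟩ := exists_int_cast_eq_of_isIntegral_ratCast (hyq ▸ hy)
  -- the integer identity `u · p · num r = c · z · den r`
  have hcQ : (D.maninConstant : ℚ) ≠ 0 := by exact_mod_cast D.maninConstant_ne_zero_holds
  have e1 : (u : ℚ) * p * r = D.maninConstant * z := by
    rw [hz, hq]
    field_simp
  have e2 : (u : ℚ) * p * r.num = D.maninConstant * z * r.den := by
    have hr : r * r.den = r.num := Rat.mul_den_eq_num r
    calc (u : ℚ) * p * r.num = (u : ℚ) * p * r * r.den := by rw [← hr]; ring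
      _ = D.maninConstant * z * r.den := by rw [e1]
  have e3 : (u : ℤ) * p * r.num = D.maninConstant * z * r.den := by exact_mod_cast e2
  -- `p² ∣ c` forces `p ∣ u · num r`
  obtain ⟨k, hk⟩ := hdvd
  have hpZ : Prime (p : ℤ) := Nat.prime_iff_prime_int.mp hp
  have hdiv : (p : ℤ) ∣ (u : ℤ) * r.num := by
    have e4 : (p : ℤ) * ((u : ℤ) * r.num) = (p : ℤ) * ((p : ℤ) * k * z * r.den) := by
      calc (p : ℤ) * ((u : ℤ) * r.num) = (u : ℤ) * p * r.num := by ring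
        _ = D.maninConstant * z * r.den := e3
        _ = (p : ℤ) * ((p : ℤ) * k * z * r.den) := by rw [hk]; ring
    have e5 : (u : ℤ) * r.num = (p : ℤ) * k * z * r.den :=
      mul_left_cancel₀ (by exact_mod_cast hp.ne_zero) e4
    exact ⟨k * z * r.den, by rw [e5]; ring⟩
  rcases hpZ.dvd_or_dvd hdiv with h1 | h1
  · exact hu (Int.natCast_dvd_natCast.mp h1)
  · exact hnum h1

end Summit.BirchSwinnertonDyer.Rank1Residual.ManinAdditive

end
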